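import Summits.NavierStokesRegularity.NavierStokesRegularity.Theorems.StrainDoorsSupTypeIScaledEnergies
import HarnessLib

/-!
# Strain doors, PART M §M28(e)–(f) — the `L²`-Morrey Type-I bound from the sup-norm Type-I rate in the
# energy class (door X′ of ROUND 68 closed)

ROUND 69 of the `ns-regularity-ideate` programme (p1 line; helper lane of `stmt-NavierStokesRegularity-0056`,
rung N0; nothing here is a claim about Navier–Stokes regularity).  ROUND 68 proved Barker–Prange's Theorem 3 with
one fixed `δ₀` on one sequence of slices for solutions which are Type I both in the sup-norm (`|u| ≤ M/√(T − t)`)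
and in the `L²`-Morrey sense (`‖u(t)‖_{L²(B_r(y))} ≤ M₂√r`, `T − r² < t < T`), and typed the door X′: «the
sup-norm rate plus the energy class give the Morrey bound with `M₂ = M₂(M, ‖u₀‖₂, T)`».  ROUND 69 PROVES X′ in
three texts: `StrainDoorsSupTypeIScaledEnergies` (§M28(a)–(d): the rate interpolation and the base-scale data),
`StrainDoorsMorreyBoundFromSupTypeI` (§M28(e)–(f): Seregin's iteration with data-uniform constants and the Morrey
bound), `StrainDoorsFixedDeltaSupTypeI` (§M28(g)–(i): the fixed-`δ₀` criterion and the every-slice concentration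
made unconditional in the energy class; door X″ typed).

THIS FILE (imports §M28(a)–(d) `StrainDoorsSupTypeIScaledEnergies`; tree otherwise):
* §M28(e) `exists_cknAEss_le_of_supTypeI` — Seregin's iteration in the tree's QUANTIFIER-UNIFORM form
  `AlbrittonBarker2019.uniform_bound_of_interp_uniform` (the bound `K(M, E₀, r₀)` is fixed BEFORE the solution):
  `A(Q(z', ρ)) ≤ K` for every ball `Q(z', r₀)` of the strip and `ρ ≤ r₀/2`;
* §M28(f) ★★★ `morreyBound_of_supTypeI` — door X′: for `M, E₀`, `T₀ > 0` ONE `M₂ = M₂(M, E₀, T₀)` such that every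
  classical Leray–Hopf solution on `[0,T)`, `T ≥ T₀`, with `∫|u₀|² ≤ E₀` and `|u| ≤ M/√(T − t)` has
  `‖u(t)‖_{L²(B_r(y))} ≤ M₂ √r` for all `y`, `r > 0`, `max(0, T − r²) < t < T` — exactly the Morrey hypothesis of
  ROUND 68's `sliceAligned_fixedDelta_not_singular_of_morreyTypeI`.
In print the step «sup-norm Type I ⇒ Morrey-type bound» is Barker–Prange 2020 p. 5 (via Seregin–Zajączkowski /
Seregin 2007), with a constant `M(M′, u₀, r)` depending on the solution and a radius cap; the data-uniform
dependence `(M, ‖u₀‖₂, T₀)` at all radii is the tree's `LocalTypeIWeakSerrinUniform` bookkeeping plus the energy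
inequality at large radii.  No `sorry`, no new axioms, no instances, no notation, no definitions.
-/

noncomputable section

set_option linter.dupNamespace false

open MeasureTheory Set Function Filter Metric Real
open _root_.Topology
open scoped ENNReal NNReal
open Literature.Analysis Literature.Analysis.FluidPDE

namespace Summit.NavierStokesRegularity.NavierStokesRegularity.Theorems.StrainDoors

/-! ### §M28(e) The scaled energy is bounded near the top of the strip, with DATA-UNIFORM constants -/

/-- **Seregin's iteration with the rate interpolation, at every parabolic ball of the strip.**  For all
`M, E₀` and `0 < r₀ ≤ 1` there is `K = K(M, E₀, r₀) < ∞` such that for every classical solution of the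
Navier–Stokes system on `ℝ³ × [0,T)` (`ν = 1`), Leray–Hopf on `[0,T)`, with `∫|u₀|² ≤ E₀` and
`|u(t,x)| ≤ M/√(T − t)` on `(0,T)`, and every parabolic ball `Q(z', r₀)` of the strip (`r₀² ≤ t' ≤ T`):
`A(Q(z', ρ)) ≤ K` for `0 < ρ ≤ r₀/2`.  Proof: the tree's quantifier-uniform Albritton–Barker Lemma 2.6
(`AlbrittonBarker2019.uniform_bound_of_interp_uniform`) on the open ball `Q(z', r₀)` for the gauged pair
(`SereginSverak2002.isSuitableWeakSolutionOn_gauge_of_classical`, the Leray–Hopf weak gradient), fed with the rate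
interpolation of §M28(b) and the base-scale data of §M28(c).
[cite: AlbrittonBarker2019, Lemmas 2.5–2.6 (arXiv:1811.00502 §2); Seregin2007, Thm 1.3; SereginZajaczkowski2007] -/
theorem exists_cknAEss_le_of_supTypeI (M E₀ : ℝ) {r₀ : ℝ} (hr₀ : 0 < r₀) (hr₀1 : r₀ ≤ 1) :
    ∃ K : ℝ≥0∞, K ≠ ⊤ ∧
      ∀ (T : ℝ) (u : ℝ → EuclideanSpace ℝ (Fin 3) → EuclideanSpace ℝ (Fin 3))
        (p : ℝ → EuclideanSpace ℝ (Fin 3) → ℝ), 0 < T →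
        IsClassicalNSSolutionOn (Ico 0 T) 1 0 u p → IsLerayHopfOn T 1 0 (u 0) u →
        ∫ x, ‖u 0 x‖ ^ 2 ≤ E₀ →
        (∀ t ∈ Ioo 0 T, ∀ x : EuclideanSpace ℝ (Fin 3), ‖u t x‖ ≤ M / Real.sqrt (T - t)) →
        ∀ z' : ℝ × EuclideanSpace ℝ (Fin 3), z'.1 ≤ T → r₀ ^ 2 ≤ z'.1 →
          ∀ ρ ∈ Ioc (0 : ℝ) (r₀ / 2), cknAEss ρ z' u ≤ K := by
  -- ### the three levels
  set κ : ℝ≥0∞ := 4 * volume (ball (0 : EuclideanSpace ℝ (Fin 3)) 1) ^ (1 / 4 : ℝ) *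
    ENNReal.ofReal (|M| ^ (3 / 2 : ℝ)) with hκ
  have hκtop : κ ≠ ⊤ := ENNReal.mul_ne_top (ENNReal.mul_ne_top ENNReal.ofNat_ne_top
    (ENNReal.rpow_ne_top_of_nonneg (by norm_num) measure_ball_lt_top.ne)) ENNReal.ofReal_ne_top
  have hr₀0 : ENNReal.ofReal r₀ ≠ 0 := (ENNReal.ofReal_pos.2 hr₀).ne'
  set A₀ : ℝ≥0∞ := (ENNReal.ofReal r₀)⁻¹ * ENNReal.ofReal E₀ with hA₀
  have hA₀top : A₀ ≠ ⊤ := ENNReal.mul_ne_top (ENNReal.inv_ne_top.2 hr₀0) ENNReal.ofReal_ne_top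
  set D₀ : ℝ≥0∞ := (ENNReal.ofReal r₀ ^ 2)⁻¹ *
    (((steinConstThreeHalves : ℝ≥0∞) ^ (3 / 2 : ℝ) * ENNReal.ofReal |M| * ENNReal.ofReal E₀) *
      ENNReal.ofReal (2 * r₀)) with hD₀
  have hD₀top : D₀ ≠ ⊤ := by
    refine ENNReal.mul_ne_top (ENNReal.inv_ne_top.2 (pow_ne_zero 2 hr₀0)) ?_
    refine ENNReal.mul_ne_top (ENNReal.mul_ne_top (ENNReal.mul_ne_top ?_ ENNReal.ofReal_ne_top)
      ENNReal.ofReal_ne_top) ENNReal.ofReal_ne_top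
    exact ENNReal.rpow_ne_top_of_nonneg (by norm_num) ENNReal.coe_ne_top
  obtain ⟨K, hKtop, hK⟩ := AlbrittonBarker2019.uniform_bound_of_interp_uniform hκtop hA₀top hD₀top
  refine ⟨K, hKtop, ?_⟩
  intro T u p hT hcl hLH hE hI z' hz'T hz'0 ρ hρ
  -- ### the open ball `Q(z', r₀)` in the strip and the gauged pair there
  set Q : TopologicalSpace.Opens (ℝ × EuclideanSpace ℝ (Fin 3)) := parabolicCylinderOpens r₀ z' with hQdef
  have hQ : (Q : Set (ℝ × EuclideanSpace ℝ (Fin 3))) = parabolicCylinder r₀ z' := rfl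
  have hQslab : (Q : Set (ℝ × EuclideanSpace ℝ (Fin 3))) ⊆
      Ioo 0 T ×ˢ (univ : Set (EuclideanSpace ℝ (Fin 3))) := by
    rw [hQ]
    rintro ⟨s, x⟩ hw
    rw [mem_parabolicCylinder] at hw
    exact ⟨⟨by linarith [hw.1.1], lt_of_lt_of_le hw.1.2 hz'T⟩, mem_univ _⟩
  set q : ℝ → EuclideanSpace ℝ (Fin 3) → ℝ :=
    fun t x => p t x - (p t 0 - normalisedPressure (u t) 0) with hq
  have hsw : IsSuitableWeakSolutionOn Q 1 0 u q :=
    SereginSverak2002.isSuitableWeakSolutionOn_gauge_of_classical one_pos hT hcl hLH Q hQslab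
  obtain ⟨G, hGslab, -, -, -⟩ := hLH.exists_hasWeakSpatialGradientOn
  have hle : Q ≤ slab (EuclideanSpace ℝ (Fin 3)) (Ioo 0 T) isOpen_Ioo := by
    intro z hz
    change z ∈ Ioo 0 T ×ˢ (univ : Set (EuclideanSpace ℝ (Fin 3)))
    exact hQslab hz
  have hG : HasWeakSpatialGradientOn Q u G := hGslab.mono hle
  -- ### the rate interpolation on the sub-balls
  have hcont : ContinuousOn (uncurry u) (Ico 0 T ×ˢ (univ : Set (EuclideanSpace ℝ (Fin 3)))) :=
    hcl.smooth_velocity.continuousOn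
  have hI' : ∀ t ∈ Ioo 0 T, ∀ x : EuclideanSpace ℝ (Fin 3), ‖u t x‖ ≤ |M| / Real.sqrt (T - t) :=
    fun t ht x => (hI t ht x).trans (div_le_div_of_nonneg_right (le_abs_self M) (Real.sqrt_nonneg _))
  have hinterp : ∀ (z'' : ℝ × EuclideanSpace ℝ (Fin 3)) (ρ' : ℝ), 0 < ρ' →
      parabolicCylinder ρ' z'' ⊆ (Q : Set (ℝ × EuclideanSpace ℝ (Fin 3))) →
      cknC ρ' z'' u ≤ κ * cknAEss ρ' z'' u ^ (3 / 4 : ℝ) := by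
    intro z'' ρ' hρ' hsub
    rw [hQ] at hsub
    obtain ⟨h1, h2, -⟩ := AlbrittonBarker2019.margins_of_parabolicCylinder_subset hρ' hsub
    have h3 : ρ' ≤ r₀ := AlbrittonBarker2019.radius_le_of_parabolicCylinder_subset hρ' hsub
    exact cknC_le_of_supRate (abs_nonneg M) hcont hI' hρ' (h3.trans hr₀1) (h1.trans hz'T) (by nlinarith)
  -- ### the base-scale data
  have hA : cknAEss r₀ z' u ≤ A₀ := cknAEss_le_of_energy hLH hE hz'T hz'0
  have hD : cknD r₀ z' q ≤ D₀ := cknD_gauge_le_of_supRate hT hcl hLH hE hI hr₀ hz'T hz'0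
  -- ### conclude
  have hfin := hK Q u q G hsw hG hinterp z' r₀ hr₀ (by rw [hQ]) hA hD ρ hρ
  exact le_trans (le_add_right (le_add_right (le_add_right le_rfl))) hfin

/-! ### §M28(f) ★★★ Door X′ closed: the energy-class Morrey bound from the sup-norm Type-I rate -/

/-- ★★★ **THE `L²`-MORREY TYPE-I BOUND FROM THE SUP-NORM TYPE-I RATE, IN THE ENERGY CLASS** (door X′ of
ROUND 68 §4, closed).  For all `M, E₀` and `T₀ > 0` there is `M₂ = M₂(M, E₀, T₀) > 0` such that every classical
solution of the Navier–Stokes system on `ℝ³ × [0,T)`, `T ≥ T₀`, Leray–Hopf on `[0,T)`, with `∫|u₀|² ≤ E₀` and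
`|u(t,x)| ≤ M/√(T − t)` on `(0,T)`, satisfies the Morrey-type Type-I bound of Barker–Prange's
concentration theorem at ALL radii: `‖u(t)‖_{L²(B_r(y))} ≤ M₂ √r` for every `y`, `r > 0` and
`max(0, T − r²) < t < T`.
Large radii (`r ≥ r₀/4`, `r₀ = min(1, √T₀/2)`): the global energy.  Small radii: §M28(e) on the ball
`Q((t', y), r₀)`, `t' = min(T, t + r²)`, at the radius `2r ≤ r₀/2`, and §M28(d) at the slice `t`.  In print the
passage from the sup-norm rate to the Morrey bound is routed through Seregin–Zajączkowski / Seregin 2007 with a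
constant depending on the solution (Barker–Prange 2020, p. 5); here the dependence is on `(M, ‖u₀‖₂, T₀)` only.
[cite: BarkerPrange2020, p. 5 (arXiv:1812.09115 p. 5) and Thm 2; AlbrittonBarker2019, Lemmas 2.5–2.6;
Seregin2007, Thm 1.3; SereginZajaczkowski2007] -/
theorem morreyBound_of_supTypeI (M E₀ T₀ : ℝ) (hT₀ : 0 < T₀) :
    ∃ M₂ : ℝ, 0 < M₂ ∧
      ∀ (T : ℝ) (u : ℝ → EuclideanSpace ℝ (Fin 3) → EuclideanSpace ℝ (Fin 3))
        (p : ℝ → EuclideanSpace ℝ (Fin 3) → ℝ), T₀ ≤ T →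
        IsClassicalNSSolutionOn (Ico 0 T) 1 0 u p → IsLerayHopfOn T 1 0 (u 0) u →
        ∫ x, ‖u 0 x‖ ^ 2 ≤ E₀ →
        (∀ t ∈ Ioo 0 T, ∀ x : EuclideanSpace ℝ (Fin 3), ‖u t x‖ ≤ M / Real.sqrt (T - t)) →
        ∀ (y : EuclideanSpace ℝ (Fin 3)) (r : ℝ), 0 < r → ∀ t : ℝ, 0 < t → T - r ^ 2 < t → t < T →
          eLpNorm (u t) 2 (volume.restrict (ball y r)) ≤ ENNReal.ofReal (M₂ * Real.sqrt r) := by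
  -- ### the base radius `r₀ = min(1, √T₀/2)`
  set r₀ : ℝ := min 1 (Real.sqrt T₀ / 2) with hr₀def
  have hr₀ : 0 < r₀ := lt_min one_pos (by positivity)
  have hr₀1 : r₀ ≤ 1 := min_le_left _ _
  have hr₀sq : 4 * r₀ ^ 2 ≤ T₀ := by
    have h1 : r₀ ≤ Real.sqrt T₀ / 2 := min_le_right _ _
    have h2 := pow_le_pow_left₀ hr₀.le h1 2
    rw [div_pow, Real.sq_sqrt hT₀.le] at h2
    linarith
  obtain ⟨K, hKtop, hK⟩ := exists_cknAEss_le_of_supTypeI M E₀ hr₀ hr₀1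
  -- ### the constant
  set E₁ : ℝ := max E₀ 0 with hE₁
  have hE₁0 : 0 ≤ E₁ := le_max_right _ _
  set M₂ : ℝ := Real.sqrt (2 * K.toReal) + Real.sqrt (E₁ / (r₀ / 4)) + 1 with hM₂def
  have hs1 : 0 ≤ Real.sqrt (2 * K.toReal) := Real.sqrt_nonneg _
  have hs2 : 0 ≤ Real.sqrt (E₁ / (r₀ / 4)) := Real.sqrt_nonneg _
  have hM₂ : 0 < M₂ := by rw [hM₂def]; linarith
  have hM₂K : 2 * K.toReal ≤ M₂ ^ 2 := by
    have h := Real.sq_sqrt (by positivity : (0 : ℝ) ≤ 2 * K.toReal)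
    nlinarith
  have hM₂E : E₁ / (r₀ / 4) ≤ M₂ ^ 2 := by
    have h := Real.sq_sqrt (by positivity : (0 : ℝ) ≤ E₁ / (r₀ / 4))
    nlinarith
  refine ⟨M₂, hM₂, ?_⟩
  intro T u p hT hcl hLH hE hI y r hr t ht0 hwin htT
  have hTpos : 0 < T := hT₀.trans_le hT
  have hcont : ContinuousOn (uncurry u) (Ico 0 T ×ˢ (univ : Set (EuclideanSpace ℝ (Fin 3)))) :=
    hcl.smooth_velocity.continuousOn
  have hsqr : 0 < Real.sqrt r := Real.sqrt_pos.2 hr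
  have hsq2 : (M₂ * Real.sqrt r) ^ 2 = M₂ ^ 2 * r := by rw [mul_pow, Real.sq_sqrt hr.le]
  suffices hgoal : ∫⁻ x in ball y r, ‖u t x‖ₑ ^ 2 ≤ ENNReal.ofReal ((M₂ * Real.sqrt r) ^ 2) from
    eLpNorm_two_le_of_lintegral_sq_le (by positivity) hgoal
  rw [hsq2]
  rcases le_or_gt (r₀ / 4) r with hbig | hsmall
  · -- ### large radii: the global energy
    have hkin : 2 * VectorCalculus.kineticEnergy (u 0) ≤ E₁ := by
      rw [VectorCalculus.kineticEnergy, ← mul_assoc, mul_inv_cancel₀ (two_ne_zero), one_mul]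
      exact hE.trans (le_max_left _ _)
    have hE₁r : E₁ ≤ M₂ ^ 2 * r := by
      have h1 : E₁ = E₁ / (r₀ / 4) * (r₀ / 4) := by field_simp
      rw [h1]
      exact mul_le_mul hM₂E hbig (by positivity) (by positivity)
    calc ∫⁻ x in ball y r, ‖u t x‖ₑ ^ 2 ≤ ∫⁻ x, ‖u t x‖ₑ ^ 2 := setLIntegral_le_lintegral _ _
      _ ≤ ENNReal.ofReal (2 * VectorCalculus.kineticEnergy (u 0)) :=
          SereginSverak2002.eEnergy_le zero_le_one hLH ⟨ht0.le, htT.le⟩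
      _ ≤ ENNReal.ofReal (M₂ ^ 2 * r) := ENNReal.ofReal_le_ofReal (hkin.trans hE₁r)
  · -- ### small radii: the local iteration about `(t', y)`, `t' = min(T, t + r²)`, at the radius `2r`
    set t' : ℝ := min T (t + r ^ 2) with ht'def
    have ht'T : t' ≤ T := min_le_left _ _
    have htt' : t < t' := lt_min htT (by nlinarith)
    have ht'le : t' ≤ t + r ^ 2 := min_le_right _ _
    have hr₀t' : r₀ ^ 2 ≤ t' := by nlinarith
    have h2r : 2 * r ∈ Ioc (0 : ℝ) (r₀ / 2) := ⟨by linarith, by linarith⟩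
    have hA := hK T u p hTpos hcl hLH hE hI (t', y) ht'T hr₀t' (2 * r) h2r
    have h4r : (2 * r) ^ 2 ≤ t' := by nlinarith
    have hwin' : t ∈ Ioo (t' - (2 * r) ^ 2) t' := ⟨by nlinarith, htt'⟩
    have hslice := lintegral_ball_le_of_cknAEss_le hcont (z' := (t', y)) (by linarith) ht'T h4r hA t hwin'
    have hKr : ENNReal.ofReal (2 * r) * K = ENNReal.ofReal (2 * r * K.toReal) := by
      rw [ENNReal.ofReal_mul (by linarith : (0 : ℝ) ≤ 2 * r), ENNReal.ofReal_toReal hKtop]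
    calc ∫⁻ x in ball y r, ‖u t x‖ₑ ^ 2 ≤ ∫⁻ x in ball y (2 * r), ‖u t x‖ₑ ^ 2 :=
          lintegral_mono_set (ball_subset_ball (by linarith))
      _ ≤ ENNReal.ofReal (2 * r) * K := hslice
      _ = ENNReal.ofReal (2 * r * K.toReal) := hKr
      _ ≤ ENNReal.ofReal (M₂ ^ 2 * r) := by
          refine ENNReal.ofReal_le_ofReal ?_
          nlinarith [hM₂K, hr]

end Summit.NavierStokesRegularity.NavierStokesRegularity.Theorems.StrainDoors

end
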